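import Mathlib
import Summits.Ventures.PercRepro2.SwOutCrossGenThm

/-!
# The fibre data of three dropped vertices on a path (blind cell PercRepro2, night-4 g23,
2026-08-28; proofs/NIGHT4-G23.md §8)

Three dropped vertices `p₁, p₂, p₃`, each joined to `u`, with the cross edges `p₁p₂` and `p₂p₃`
(a path): the fibre `Fib3 = (uP₁, uP₂, uP₃, c₁₂, c₂₃, e₁, e₂, e₃)`, attachment transitive along the
red cross edges, the links in the graph on `{u, p₁, p₂, p₃}` (a red link between two red ports,
a blue link between two blue ports), the partition order (`Label3.Better`: outside bits no
larger, red links of the old red ports kept, blue links of the new blue ports not created), the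
GENERIC slab injection `Fib3.psi` (flip the structure, keep the outside bits of the unattached
vertices, clear those of the attached ones; the all-dropped point with all outside edges blue goes
to all red) with its retraction `Fib3.psiInv`, and the core pairs `(uP = e = 000, c) ↔ (111, ¬c)`.
Every finite fact is checked by `decide` on the 256 fibre points; **`card_le_crossK3`** is the
generic theorem on `fibK3`.
-/

namespace Summit.Ventures.PercRepro2

namespace CrossArm

/-- A fibre point of three dropped vertices on a path. -/
structure Fib3 where
  /-- the u–`p₁` edge -/
  uP₁ : Bool
  /-- the u–`p₂` edge -/
  uP₂ : Bool
  /-- the u–`p₃` edge -/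
  uP₃ : Bool
  /-- the cross edge `p₁p₂` -/
  c₁₂ : Bool
  /-- the cross edge `p₂p₃` -/
  c₂₃ : Bool
  /-- the outside edges of `p₁` -/
  e₁ : Bool
  /-- the outside edges of `p₂` -/
  e₂ : Bool
  /-- the outside edges of `p₃` -/
  e₃ : Bool
  deriving DecidableEq

/-- The fibre points as an eight-fold product of `Bool`. -/
def Fib3.equivProd : Fib3 ≃ Bool × Bool × Bool × Bool × Bool × Bool × Bool × Bool where
  toFun w := (w.uP₁, w.uP₂, w.uP₃, w.c₁₂, w.c₂₃, w.e₁, w.e₂, w.e₃)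
  invFun x := ⟨x.1, x.2.1, x.2.2.1, x.2.2.2.1, x.2.2.2.2.1, x.2.2.2.2.2.1, x.2.2.2.2.2.2.1,
    x.2.2.2.2.2.2.2⟩
  left_inv w := by cases w; rfl
  right_inv x := rfl

/-- Finitely many fibre points. -/
instance : Fintype Fib3 := Fintype.ofEquiv _ Fib3.equivProd.symm

/-- The flip. -/
def Fib3.flip (w : Fib3) : Fib3 :=
  ⟨!w.uP₁, !w.uP₂, !w.uP₃, !w.c₁₂, !w.c₂₃, !w.e₁, !w.e₂, !w.e₃⟩

/-- `p₁` attached to `u` (directly, or through red cross edges). -/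
def Fib3.att₁ (w : Fib3) : Bool := w.uP₁ || (w.c₁₂ && w.uP₂) || (w.c₁₂ && w.c₂₃ && w.uP₃)
/-- `p₂` attached to `u`. -/
def Fib3.att₂ (w : Fib3) : Bool := w.uP₂ || (w.c₁₂ && w.uP₁) || (w.c₂₃ && w.uP₃)
/-- `p₃` attached to `u`. -/
def Fib3.att₃ (w : Fib3) : Bool := w.uP₃ || (w.c₂₃ && w.uP₂) || (w.c₂₃ && w.c₁₂ && w.uP₁)
/-- The cross edge `p₁p₂` in the cluster of `u`. -/
def Fib3.attC₁₂ (w : Fib3) : Bool := w.c₁₂ && w.att₁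
/-- The cross edge `p₂p₃` in the cluster of `u`. -/
def Fib3.attC₂₃ (w : Fib3) : Bool := w.c₂₃ && w.att₂

/-- The red-side leak. -/
def Fib3.LeakR (w : Fib3) : Bool :=
  (w.att₁ && !w.e₁) || (w.att₂ && !w.e₂) || (w.att₃ && !w.e₃)

/-- The core points: uniform attachment with matching outside bits. -/
def Fib3.Core (w : Fib3) : Bool :=
  (w.uP₁ == w.uP₂) && (w.uP₂ == w.uP₃) && (w.e₁ == w.uP₁) && (w.e₂ == w.uP₁) && (w.e₃ == w.uP₁)

/-- `p₁, p₂` joined by a red path inside `{u, p₁, p₂, p₃}`. -/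
def Fib3.rl₁₂ (w : Fib3) : Bool := w.c₁₂ || (w.uP₁ && w.uP₂) || (w.uP₁ && w.uP₃ && w.c₂₃)
/-- `p₂, p₃` joined by a red path inside `{u, p₁, p₂, p₃}`. -/
def Fib3.rl₂₃ (w : Fib3) : Bool := w.c₂₃ || (w.uP₂ && w.uP₃) || (w.uP₃ && w.uP₁ && w.c₁₂)
/-- `p₁, p₃` joined by a red path inside `{u, p₁, p₂, p₃}`. -/
def Fib3.rl₁₃ (w : Fib3) : Bool :=
  (w.c₁₂ && w.c₂₃) || (w.uP₁ && w.uP₃) || (w.c₁₂ && w.uP₂ && w.uP₃) || (w.uP₁ && w.uP₂ && w.c₂₃)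

/-- The label: the outside bits, the red links between red ports, the blue links between blue
ports. -/
structure Label3 where
  /-- outside bit of `p₁` -/
  e₁ : Bool
  /-- outside bit of `p₂` -/
  e₂ : Bool
  /-- outside bit of `p₃` -/
  e₃ : Bool
  /-- red link `p₁p₂` (both red ports) -/
  rl₁₂ : Bool
  /-- red link `p₁p₃` -/
  rl₁₃ : Bool
  /-- red link `p₂p₃` -/
  rl₂₃ : Bool
  /-- blue link `p₁p₂` (both blue ports) -/
  bl₁₂ : Bool
  /-- blue link `p₁p₃` -/
  bl₁₃ : Bool
  /-- blue link `p₂p₃` -/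
  bl₂₃ : Bool
  deriving DecidableEq

/-- The labels as a nine-fold product of `Bool`. -/
def Label3.equivProd : Label3 ≃ Bool × Bool × Bool × Bool × Bool × Bool × Bool × Bool × Bool where
  toFun l := (l.e₁, l.e₂, l.e₃, l.rl₁₂, l.rl₁₃, l.rl₂₃, l.bl₁₂, l.bl₁₃, l.bl₂₃)
  invFun x := ⟨x.1, x.2.1, x.2.2.1, x.2.2.2.1, x.2.2.2.2.1, x.2.2.2.2.2.1, x.2.2.2.2.2.2.1,
    x.2.2.2.2.2.2.2.1, x.2.2.2.2.2.2.2.2⟩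
  left_inv l := by cases l; rfl
  right_inv x := rfl

/-- Finitely many labels. -/
instance : Fintype Label3 := Fintype.ofEquiv _ Label3.equivProd.symm

/-- The label of a fibre point. -/
def Fib3.label (w : Fib3) : Label3 :=
  ⟨w.e₁, w.e₂, w.e₃,
    !w.e₁ && !w.e₂ && w.rl₁₂, !w.e₁ && !w.e₃ && w.rl₁₃, !w.e₂ && !w.e₃ && w.rl₂₃,
    w.e₁ && w.e₂ && w.flip.rl₁₂, w.e₁ && w.e₃ && w.flip.rl₁₃, w.e₂ && w.e₃ && w.flip.rl₂₃⟩

/-- The Boolean form of the label order: outside bits no larger; a red link between two red ports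
of `l` is kept; a blue link between two blue ports of `l'` was already there. -/
def Label3.betterB (l' l : Label3) : Bool :=
  (l.e₁ || !l'.e₁) && (l.e₂ || !l'.e₂) && (l.e₃ || !l'.e₃) &&
  (l.e₁ || l.e₂ || !l.rl₁₂ || l'.rl₁₂) && (l.e₁ || l.e₃ || !l.rl₁₃ || l'.rl₁₃) &&
  (l.e₂ || l.e₃ || !l.rl₂₃ || l'.rl₂₃) &&
  (!l'.e₁ || !l'.e₂ || !l'.bl₁₂ || l.bl₁₂) && (!l'.e₁ || !l'.e₃ || !l'.bl₁₃ || l.bl₁₃) &&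
  (!l'.e₂ || !l'.e₃ || !l'.bl₂₃ || l.bl₂₃)

/-- `l'` is at least as good a label as `l`. -/
def Label3.Better (l' l : Label3) : Prop := Label3.betterB l' l = true

/-- `Label3.Better` is decidable. -/
instance Label3.instDecidableBetter (l' l : Label3) : Decidable (Label3.Better l' l) :=
  inferInstanceAs (Decidable (Label3.betterB l' l = true))

/-- `Label3.Better` is reflexive. -/
lemma Label3.Better_refl : ∀ l : Label3, Label3.Better l l := by decide +kernel

/-- The generic slab injection: flip the structure, keep the outside bits of the unattached vertices
and clear those of the attached ones; the all-dropped point with all outside edges blue goes to all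
red. -/
def Fib3.psi (w : Fib3) : Fib3 :=
  if w.uP₁ = false ∧ w.uP₂ = false ∧ w.uP₃ = false ∧ w.e₁ = true ∧ w.e₂ = true ∧ w.e₃ = true then
    ⟨true, true, true, !w.c₁₂, !w.c₂₃, false, false, false⟩
  else
    ⟨!w.uP₁, !w.uP₂, !w.uP₃, !w.c₁₂, !w.c₂₃, w.e₁ && !w.att₁, w.e₂ && !w.att₂, w.e₃ && !w.att₃⟩

/-- The retraction of the slab injection on its domain. -/
def Fib3.psiInv (v : Fib3) : Fib3 :=
  let w₀ : Fib3 := ⟨!v.uP₁, !v.uP₂, !v.uP₃, !v.c₁₂, !v.c₂₃, true, true, true⟩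
  if v.uP₁ = true ∧ v.uP₂ = true ∧ v.uP₃ = true ∧ v.e₁ = false ∧ v.e₂ = false ∧ v.e₃ = false then
    w₀
  else
    ⟨!v.uP₁, !v.uP₂, !v.uP₃, !v.c₁₂, !v.c₂₃, v.e₁ || w₀.att₁, v.e₂ || w₀.att₂, v.e₃ || w₀.att₃⟩

/-- The fibre atoms. -/
inductive AtomP3 where
  /-- `p₁` -/
  | p₁ : AtomP3
  /-- `p₂` -/
  | p₂ : AtomP3
  /-- `p₃` -/
  | p₃ : AtomP3
  /-- the cross edge `p₁p₂` -/
  | c₁₂ : AtomP3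
  /-- the cross edge `p₂p₃` -/
  | c₂₃ : AtomP3
  deriving DecidableEq, Fintype

/-- The red fibre atoms of a point. -/
def Fib3.red (w : Fib3) : AtomP3 → Bool
  | AtomP3.p₁ => w.att₁
  | AtomP3.p₂ => w.att₂
  | AtomP3.p₃ => w.att₃
  | AtomP3.c₁₂ => w.attC₁₂
  | AtomP3.c₂₃ => w.attC₂₃

/-- The lower core points: everything dropped with red outside edges, the cross edges free. -/
def core0K3 : Finset Fib3 :=
  {⟨false, false, false, false, false, false, false, false⟩,
   ⟨false, false, false, false, true, false, false, false⟩,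
   ⟨false, false, false, true, false, false, false, false⟩,
   ⟨false, false, false, true, true, false, false, false⟩}

/-- The retraction recovers a non-core point without red-side leak from its image. -/
lemma Fib3.psiInv_psi : ∀ w : Fib3, w.LeakR = false → w.Core = false → w.psi.psiInv = w := by
  decide +kernel

/-- The slab injection is injective on its domain. -/
lemma Fib3.psi_inj (w w' : Fib3) (h : w.LeakR = false) (hc : w.Core = false) (h' : w'.LeakR = false)
    (hc' : w'.Core = false) (heq : w.psi = w'.psi) : w = w' := by
  rw [← Fib3.psiInv_psi w h hc, heq, Fib3.psiInv_psi w' h' hc']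

/-- The fibre data of three dropped vertices on a path. -/
def fibK3 : FibreData Fib3 AtomP3 Label3 where
  flip := Fib3.flip
  flip_flip := by decide +kernel
  red := Fib3.red
  leakR := Fib3.LeakR
  core := Fib3.Core
  label := Fib3.label
  BetterL := Label3.Better
  betterL_refl := Label3.Better_refl
  psi := Fib3.psi
  core_of_noLeak := by decide +kernel
  leakR_core := by decide +kernel
  leakR_flip_core := by decide +kernel
  core_flip := by decide +kernel
  psi_ok := by decide +kernel
  psi_inj := Fib3.psi_inj
  core0 := core0K3
  core0_core := by decide +kernel
  core_cases := by decide +kernel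
  flip_core0 := by decide +kernel
  pair_label := by decide +kernel
  pair_red := by decide +kernel

open scoped Classical in
/-- **The abstract theorem of boundary (iv) for three dropped vertices on a path**, from the
generic theorem. -/
theorem card_le_crossK3 {ι : Type*} [Fintype ι] [DecidableEq ι] [Nonempty ι]
    {𝒯 : Set (TypG Label3 ι)} (h𝒯 : IsUpG fibK3 𝒯) {𝓔 : Set (Set (AtomG AtomP3 ι))}
    (h𝓔 : IsUpperSet 𝓔) :
    ((QG fibK3 𝒯).filter fun q => ERG fibK3 q ∈ 𝓔).card ≤
      ((QG fibK3 𝒯).filter fun q => EBG fibK3 q ∈ 𝓔).card :=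
  card_le_crossGen h𝒯 h𝓔

end CrossArm

end Summit.Ventures.PercRepro2
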